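import Literature.MathematicalPhysics.QuantumFieldTheory.Balaban1983to89.B15BasicStep

/-!
# `Balaban1983to89.B15RopTotal` — [Balaban1989LargeFieldI] (0.2)–(0.4) p. 176: the 𝐑 operation as a TOTAL OPERATOR on
# the densities of one lattice, built from a REPRESENTATION datum, with (0.4) `∫dV(𝐑ρ)(V) = ∫dVρ(V)` and preservation of
# integrability PROVED for every density (the shape NODE 00's record predicate asks of `Residual₅.R`)

statement-level skeleton of published theorems with citation tags; proofs where landed; nothing here is a claim about
the Yang–Mills mass gap.

Cell pub-ymgap, HUMAN RULING D-0062; seat `pub-ymgap-dag-n12-b` as INTERIM CO-DEFINER under node00-def g28 (director-ym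
LINE №17 (E1), dag-lead REBALANCE-9B; design note `HOME/pub-ymgap-dag-n12-b/STAGE7-R-SCOPING.md` v0.1): the Stage-7 object
«Bałaban's large-field operation `R` after the `(k+1)`-st transformation» is demanded by the Stage-5 record
(`Node00.Residual₅.R : … → Density (k+1) → Density (k+1)` with the two property fields (0.4) `PreservesIntegral (R p k)` and
integrability preservation — exactly what `T4Continuum.Realisation` asks of any datum).  THIS FILE is the paper-level,
carrier-generic MECHANISM of that object; the Node 00 module instantiates it at the record's types.

THE PRINT ([IV] p. 176 [PDF 2], verbatim).  *«A density ρ after some number of steps is represented in the form ρ(V) = Σ_Z ρ(Z, V)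
(0.2) where the sum is over large field regions Z, and V is a gauge field variable. A region Z is decomposed into disjoint
subregions Z′, Z″, Z = Z′ ∪ Z″ … For such a decomposition we take the density ρ(Z″, V), and we define the operation 𝐑 as
follows: (𝐑ρ)(V) = Σ_Z ρ(Z″, V) ∫dV⌈_{Z′} ρ(Z, V) / ∫dV⌈_{Z′} ρ(Z″, V). (0.3) We will prove that the densities are positive,
and the in[t]egration domains in the integrals above are nonempty, hence the denominators are positive, and the operation 𝐑
is well defined. It satisfies the basic normalization property ∫dV(𝐑ρ)(V) = ∫dVρ(V). (0.4)»*  p. 177: *«The actual procedure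
is more complicated, and it also differs from the one presented above in some technical aspects, for example in (0.3), (0.5)
we take the denominators equal not the integrals of the whole densities ρ(Z″, V), but to the integrals of some parts of
these densities»* (the object of §1 is 𝐑′ (1.100); r12's `B15Sect1Statements.rPrime1100`).

THE READING TYPED HERE (declared; node00-def's (c1) «R totalised, 𝐓-data as residual DATA»; DIVERGENCE D-b01.2 of the
cell «identity elsewhere»).  Print defines 𝐑 on REPRESENTED densities (0.2) — the decomposition is part of the
representation (2.18) [III] carried along the induction, not a function of the bare density.  The record types `R` as a
bare operator on `Density P j G`; so the representation enters as a DATUM `rep : Density P j G → RepData P j G` (regions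
`Z`, the map `Z ↦ Z″`, the bond variables of `Z′`, the pieces `ρ(Z, ·)`) and the operator is TOTALISED: on a density whose
representation datum represents it (`Σ_Z ρ(Z,·) = ρ`) and satisfies the printed provisos (pieces measurable, non-negative,
bounded; denominators nowhere zero) it is (0.3) — b01's `B15.BasicStep.RopReal` with V-DEPENDENT fibre integrals
`fibreIntegral` — and on every other density it is the identity.  With this convention (0.4) holds for EVERY density and
integrability is preserved for EVERY density — kernel theorems below, by name over b01's `integral_ropReal_eq` ∕
`integrable_normTerm` ∕ `preservesIntegral_of_rop`.

WHAT IS DEFINED ∕ PROVED (no `sorry`; axioms standard; definitions WITH BODIES; no `def … : Prop` fact).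
§1 `RepData P j G` (structure: `Region` with its own `Fintype` structure as a field — no instance registered —, `pp`, `fib`,
   `piece`), `RepData.total` (= (0.2)'s `Σ_Z ρ(Z,·)`), `RepData.Provisos`
   (p. 176's provisos, a `Prop` WITH BODY about the datum — not a named fact), `RepData.rop` (= `RopReal` of the datum).
§2 **`ropTotal rep`** — the totalised operator; `ropTotal_of_admissible` ∕ `ropTotal_of_not` (the two branches).
§3 **`preservesIntegral_ropTotal`** — (0.4) for EVERY density: `Setup.PreservesIntegral (ropTotal rep)`;
   **`integrable_ropTotal`** — `ropTotal rep ρ` is integrable whenever `ρ` is; `ropTotal_nonneg` (non-negativity on the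
   admissible branch is inherited: quotients of non-negative fibre integrals).
HONEST SCOPE.  (i) The representation datum `rep` is NOT constructed (Stage ₇b: from [IV] §1 (1.3)–(1.10), (1.71)–(1.76),
(1.99); r12's `RPrimeData` ∕ `B15DeterminingSets` are the typed neighbours); this file is the operator GIVEN the datum.
(ii) (0.3) is print's schematic 𝐑; the §1 object 𝐑′ (1.100) replaces `RopReal` by `rPrime1100` at ₇b (same totalisation,
(1.102) via r12's `normalization1102_of_fibreModel`).  (iii) «identity elsewhere» is a typing convention for a bare
operator, not a statement of the paper.  Count-neutral; NOT summit progress.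
-/

noncomputable section

open MeasureTheory
open scoped BigOperators

namespace Literature.MathematicalPhysics.QuantumFieldTheory.Balaban1983to89.B15RopTotal

open B15.BasicStep (fibreIntegral normTerm RopReal integral_ropReal_eq integrable_normTerm preservesIntegral_of_rop)

variable {P : Params} {j : ℕ} {G : Type*} [GaugeGroup G] [MeasurableSpace G] [HaarData G]

/-! ## §1. The representation datum of (0.2) -/

/-- **The representation (0.2) of a density as DATA** (*«ρ(V) = Σ_Z ρ(Z, V) where the sum is over large field regions
Z … A region Z is decomposed into disjoint subregions Z′, Z″»*): a finite index type of regions `Z`, the map `Z ↦ Z″`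
(`pp`), the bond variables of the new part `Z′` (`fib Z`, a `Finset` of positive bonds of `T^{(j)}` — the variables of
`∫dV⌈_{Z′}`), and the pieces `ρ(Z, ·)` (`piece Z`). [cite: Balaban1989LargeFieldI, (0.2) p.176] -/
structure RepData (P : Params) (j : ℕ) (G : Type*) [GaugeGroup G] where
  /-- the large-field regions `Z` of the representation -/
  Region : Type
  /-- finitely many regions -/
  [fin : Fintype Region]
  /-- `Z ↦ Z″` (the old part) -/
  pp : Region → Region
  /-- the bond variables of `Z′` (the new part, integrated out in (0.3)) -/
  fib : Region → Finset (PBond P j)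
  /-- the pieces `ρ(Z, ·)` -/
  piece : Region → Density P j G

namespace RepData

variable (d : RepData P j G)

/-- `Σ_Z ρ(Z, ·)` — the density the datum represents ((0.2)); the finite sum runs over the datum's own `Fintype` structure
(no global instance is registered — typer lint). [cite: Balaban1989LargeFieldI, (0.2) p.176] -/
def total : Density P j G := fun V => @Finset.sum d.Region ℝ _ (@Finset.univ d.Region d.fin) fun Z => d.piece Z V

/-- **The provisos of p. 176** for the datum, verbatim *«the densities are positive, and the in[t]egration domains in the
integrals above are nonempty, hence the denominators are positive»*, in the form b01's (0.4) theorem consumes: every piece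
measurable, non-negative and uniformly bounded, and every denominator fibre integral `∫dV⌈_{Z′}ρ(Z″, V)` nowhere zero.
A `Prop` with body about the datum (no fact is named). [cite: Balaban1989LargeFieldI, (0.3) p.176] -/
def Provisos [DecidableEq (PBond P j)] : Prop :=
  (∀ Z, Measurable (d.piece Z)) ∧ (∀ Z V, 0 ≤ d.piece Z V) ∧ (∃ C : ℝ, ∀ Z V, d.piece Z V ≤ C) ∧
    ∀ Z V, fibreIntegral (d.fib Z) (d.piece (d.pp Z)) V ≠ 0

/-- **(0.3) of the datum**: `(𝐑ρ)(V) = Σ_Z ρ(Z″,V)·∫dV⌈_{Z′}ρ(Z,V)/∫dV⌈_{Z′}ρ(Z″,V)` — b01's `RopReal` (V-dependent fibre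
integrals over `Setup.fieldMeasure`), at the datum's own `Fintype` structure. [cite: Balaban1989LargeFieldI, (0.3) p.176] -/
def rop [DecidableEq (PBond P j)] : Density P j G := @RopReal P j G _ _ _ _ d.Region d.fin d.piece d.pp d.fib

end RepData

/-! ## §2. The totalised operator -/

variable [DecidableEq (PBond P j)]

/-- `ρ` is ADMISSIBLE for the representation datum `rep`: the datum represents it and satisfies the provisos (the
condition under which print's (0.3) is applied). [cite: Balaban1989LargeFieldI, (0.2)–(0.3) p.176] -/
def Admissible (rep : Density P j G → RepData P j G) (ρ : Density P j G) : Prop :=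
  (rep ρ).total = ρ ∧ (rep ρ).Provisos

open Classical in
/-- **𝐑 as a TOTAL operator on the densities of `T^{(j)}`** given the representation datum `rep`: (0.3) on the admissible
densities, the identity elsewhere (DIVERGENCE D-b01.2; node00-def (c1)). [cite: Balaban1989LargeFieldI, (0.3) p.176] -/
def ropTotal (rep : Density P j G → RepData P j G) : Density P j G → Density P j G :=
  fun ρ => if Admissible rep ρ then (rep ρ).rop else ρ

/-- The admissible branch: `ropTotal rep ρ = (0.3)` of the datum. [cite: Balaban1989LargeFieldI, (0.3) p.176] -/
theorem ropTotal_of_admissible {rep : Density P j G → RepData P j G} {ρ : Density P j G} (h : Admissible rep ρ) :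
    ropTotal rep ρ = (rep ρ).rop := by
  classical
  exact if_pos h

/-- The other branch: the identity. [cite: Balaban1989LargeFieldI, (0.3) p.176 (typing convention D-b01.2)] -/
theorem ropTotal_of_not {rep : Density P j G → RepData P j G} {ρ : Density P j G} (h : ¬ Admissible rep ρ) :
    ropTotal rep ρ = ρ := by
  classical
  exact if_neg h

/-! ## §3. (0.4) and integrability for every density -/

/-- **(0.4) for the totalised operator, for EVERY density**: `∫dV(𝐑ρ)(V) = ∫dVρ(V)`, i.e. `Setup.PreservesIntegral
(ropTotal rep)` — on the admissible branch by b01's `integral_ropReal_eq` (the printed provisos are exactly its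
hypotheses), on the other branch trivially; packaged through b01's `preservesIntegral_of_rop`.
[cite: Balaban1989LargeFieldI, (0.4) p.176] -/
theorem preservesIntegral_ropTotal (rep : Density P j G → RepData P j G) : PreservesIntegral (ropTotal rep) := by
  classical
  refine preservesIntegral_of_rop (ropTotal rep) fun ρ => ?_
  by_cases h : Admissible rep ρ
  · right
    obtain ⟨htot, hm, h0, ⟨C, hC⟩, hden⟩ := h
    refine ⟨(rep ρ).Region, (rep ρ).fin, (rep ρ).piece, (rep ρ).pp, (rep ρ).fib, C, hm, h0, hC, hden, ?_, ?_⟩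
    · exact htot.symm
    · exact ropTotal_of_admissible ⟨htot, hm, h0, ⟨C, hC⟩, hden⟩
  · left
    exact ropTotal_of_not h

/-- **Integrability is preserved, for EVERY density**: if `ρ` is integrable for `Setup.fieldMeasure` then so is
`ropTotal rep ρ` (admissible branch: each (0.3)-term is integrable by b01's `integrable_normTerm`; other branch: `ρ` itself).
[cite: Balaban1989LargeFieldI, (0.3)–(0.4) p.176] -/
theorem integrable_ropTotal (rep : Density P j G → RepData P j G) {ρ : Density P j G}
    (hρ : Integrable ρ (fieldMeasure P j G)) : Integrable (ropTotal rep ρ) (fieldMeasure P j G) := by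
  classical
  by_cases h : Admissible rep ρ
  · rw [ropTotal_of_admissible h]
    letI := (rep ρ).fin
    obtain ⟨-, hm, h0, ⟨C, hC⟩, hden⟩ := h
    have hterm : ∀ Z, Integrable (normTerm ((rep ρ).fib Z) ((rep ρ).piece ((rep ρ).pp Z)) ((rep ρ).piece Z))
        (fieldMeasure P j G) :=
      fun Z => integrable_normTerm _ (hm _) (hm _) (h0 _) (hC _) (hC _) (hden Z)
    have hsum : Integrable (fun V => ∑ Z, normTerm ((rep ρ).fib Z) ((rep ρ).piece ((rep ρ).pp Z)) ((rep ρ).piece Z) V)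
        (fieldMeasure P j G) := integrable_finsetSum _ fun Z _ => hterm Z
    exact hsum
  · rw [ropTotal_of_not h]; exact hρ

/-- On the admissible branch the new density is non-negative (quotients of non-negative fibre integrals of non-negative
pieces) — *«the densities are positive»* is inherited by 𝐑ρ in the weak form `0 ≤`. [cite: Balaban1989LargeFieldI, (0.3) p.176] -/
theorem ropTotal_nonneg {rep : Density P j G → RepData P j G} {ρ : Density P j G} (h : Admissible rep ρ)
    (V : GaugeField P j G) : 0 ≤ ropTotal rep ρ V := by
  rw [ropTotal_of_admissible h]
  letI := (rep ρ).fin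
  obtain ⟨-, -, h0, -, -⟩ := h
  unfold RepData.rop RopReal
  refine Finset.sum_nonneg fun Z _ => ?_
  unfold normTerm fibreIntegral
  exact mul_nonneg (h0 _ _) (div_nonneg ENNReal.toReal_nonneg ENNReal.toReal_nonneg)

end Literature.MathematicalPhysics.QuantumFieldTheory.Balaban1983to89.B15RopTotal

end
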